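import Summits.Ventures.HSemireg.PerfectComplexRankDoor
import Mathlib.LinearAlgebra.CliffordAlgebra.Contraction
import Mathlib.LinearAlgebra.ExteriorAlgebra.Grading
import Mathlib.LinearAlgebra.ExteriorPower.Basis
import Mathlib.LinearAlgebra.Dual.Lemmas
import Mathlib.LinearAlgebra.FiniteDimensional.Lemmas
import HarnessLib

/-!
# Venture HSemireg — the polyvector contraction span in the exterior algebra: abstract form, the
# «(1, pt)» structure theorem (th-7's T_lin, FORMULA-N-th7 §N.2), and the bridge to `contractionRank`

HONEST FRAMING. Pure linear algebra in the exterior algebra `Λ V` of a vector space, written for the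
computation cell `pub-hsemireg` (seat p4; statement sheet `theory/FORMULA-N-th7.md` §N by theory seat 7).
Nothing here is a claim about any variety, and nothing here says that HC / HC_CM / HC_AV holds. Everything is
PROVED; no named fact.

For a field `K`, a `K`-space `V`, a set `L ⊆ V` («`H^{0,1}`»), a set `Θ` of linear forms on `V` («vector fields»,
intended: the forms killing `L`) and `x ∈ Λ V` (a «total Chern character»), `contractionSpan L Θ x` is the span of
the decomposable polyvector contractions `q₁ ∧ q₂ ∧ x`, `q ∧ ι_θ x`, `ι_{θ₁} ι_{θ₂} x` (`ι_θ` = Mathlib's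
`CliffordAlgebra.contractLeft θ`, the interior product). With `(V, L, Θ, x) = (H¹(A), hodgeZeroOneSet A,
vectorFieldSet A, totalExteriorClass A κ)` this is the span whose rank is `contractionRank A κ` of
`PerfectComplexRankDoor.lean` (`contractionRank_eq_rank_span`, by `rfl`).

STRUCTURE THEOREM for the class of a POINT IDEAL, `x = a·1 + b·ω` with `ω` of top degree (`ch(I_p) = 1 - [pt]`;
th-7's T_lin): if `Θ` kills `L` and `L ∧ ω = 0` then the mixed generators `q ∧ ι_θ x` VANISH and
`span L Θ x = Λ²-block ⊔ contraction-block` (`ContractionSpan.span_algebraMap_add_smul`), where the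
`Λ²`-block `span{q₁ ∧ q₂}` has dimension `C(dim L, 2)` (`finrank_wedgeBlock`) and the contraction block
`span{ι_{θ₁} ι_{θ₂} ω}` has dimension `C(dim V - dim L, 2)` for `ω ≠ 0` of top degree and `Θ = L^⊥`
(`finrank_contractBlock`, sequel file); the blocks sit in degrees `2` and `dim V - 2`, so for `dim V = 2n`,
`dim L = n`,
`n ≥ 3` the span has dimension `2·C(n, 2)` (`ContractionSpan.finrank_span_pointIdeal`, in the sequel file
`ContractionSpanPointIdeal.lean`, together with `finrank_contractBlock`). Proof technique: the
creation/annihilation (CAR) identities of Mathlib's `contractLeft` and DUAL FUNCTIONALS (`ι_λ ι_λ'` resp.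
`k ∧ k' ∧ -`) that read off the coefficients — no monomial sign bookkeeping. (The interior-product
bookkeeping `ι_θ(Λⁿ) ⊆ Λⁿ⁻¹` is the argument of the tree's `ExteriorLefschetz.ann_apply_mem`, re-proved here
to keep the import light.)

References: [BourbakiAlgebre1a3] Ch. III §7 (exterior algebra), §11 no. 9 (interior products are
antiderivations of degree `-1`); [BuchweitzFlenner2008HH] Prop. 6.4.4 (why these operators: `σ_F ∘ c_F = ⌟ ch F`).
-/

noncomputable section

open CliffordAlgebra (contractLeft)
open ExteriorAlgebra (ι)
open Literature.AlgebraicGeometry.Motives Literature.AlgebraicGeometry.HodgeTheory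

namespace Summit.Ventures.HSemireg

namespace ContractionSpan

section Ring

variable {K : Type*} [CommRing K] {V : Type*} [AddCommGroup V] [Module K V]

/-! ### 1. The span and its two pure blocks -/

/-- **The polyvector contraction span** of `x ∈ Λ V` with respect to a set `L` of vectors (acting by wedge) and a
set `Θ` of linear forms (acting by the interior product `ι_θ = contractLeft θ`): the span of
`q₁ ∧ q₂ ∧ x`, `q ∧ ι_θ x`, `ι_{θ₁} ι_{θ₂} x`. [cite: BourbakiAlgebre1a3, Ch. III §11 no. 9]
[cite: BuchweitzFlenner2008HH, Prop. 6.4.4] -/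
def span (L : Set V) (Θ : Set (Module.Dual K V)) (x : ExteriorAlgebra K V) : Submodule K (ExteriorAlgebra K V) :=
  Submodule.span K
    ({y | ∃ q₁ ∈ L, ∃ q₂ ∈ L, y = ι K q₁ * (ι K q₂ * x)} ∪
      {y | ∃ q ∈ L, ∃ θ ∈ Θ, y = ι K q * contractLeft θ x} ∪
      {y | ∃ θ₁ ∈ Θ, ∃ θ₂ ∈ Θ, y = contractLeft θ₁ (contractLeft θ₂ x)})

/-- The `Λ²`-block `span{q₁ ∧ q₂ : qᵢ ∈ L}`. [cite: BourbakiAlgebre1a3, Ch. III §7] -/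
def wedgeBlock (L : Set V) : Submodule K (ExteriorAlgebra K V) :=
  Submodule.span K {y | ∃ q₁ ∈ L, ∃ q₂ ∈ L, y = ι K q₁ * ι K q₂}

/-- The contraction block `span{ι_{θ₁} ι_{θ₂} ω : θᵢ ∈ Θ}`. [cite: BourbakiAlgebre1a3, Ch. III §11 no. 9] -/
def contractBlock (Θ : Set (Module.Dual K V)) (ω : ExteriorAlgebra K V) : Submodule K (ExteriorAlgebra K V) :=
  Submodule.span K {y | ∃ θ₁ ∈ Θ, ∃ θ₂ ∈ Θ, y = contractLeft θ₁ (contractLeft θ₂ ω)}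

/-! ### 2. CAR bookkeeping -/

/-- `v ∧ ι_θ y = θ(v)·y - ι_θ(v ∧ y)` (Mathlib's `contractLeft_ι_mul`, rearranged).
[cite: BourbakiAlgebre1a3, Ch. III §11 no. 9] -/
theorem ι_mul_contractLeft (θ : Module.Dual K V) (v : V) (y : ExteriorAlgebra K V) :
    ι K v * contractLeft θ y = θ v • y - contractLeft θ (ι K v * y) := by
  rw [CliffordAlgebra.contractLeft_ι_mul]; abel

/-- If `θ(q) = 0` and `q ∧ ω = 0` then `q ∧ ι_θ ω = 0`. [cite: BourbakiAlgebre1a3, Ch. III §11 no. 9] -/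
theorem ι_mul_contractLeft_eq_zero {θ : Module.Dual K V} {q : V} {ω : ExteriorAlgebra K V} (hθq : θ q = 0)
    (hqω : ι K q * ω = 0) : ι K q * contractLeft θ ω = 0 := by
  rw [ι_mul_contractLeft, hθq, zero_smul, hqω, map_zero, sub_zero]

/-- If `v ∧ ω = 0` (e.g. `ω` of top degree) then `v ∧ ι_θ ω = θ(v)·ω`.
[cite: BourbakiAlgebre1a3, Ch. III §11 no. 9] -/
theorem ι_mul_contractLeft_of_mul_eq_zero (θ : Module.Dual K V) {v : V} {ω : ExteriorAlgebra K V}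
    (hvω : ι K v * ω = 0) : ι K v * contractLeft θ ω = θ v • ω := by
  rw [ι_mul_contractLeft, hvω, map_zero, sub_zero]

/-- `v ∧ ι_{θ₁} ι_{θ₂} ω = θ₁(v)·ι_{θ₂} ω - θ₂(v)·ι_{θ₁} ω` when `v ∧ ω = 0`.
[cite: BourbakiAlgebre1a3, Ch. III §11 no. 9] -/
theorem ι_mul_contractLeft_contractLeft {θ₁ θ₂ : Module.Dual K V} {v : V} {ω : ExteriorAlgebra K V}
    (hvω : ι K v * ω = 0) :
    ι K v * contractLeft θ₁ (contractLeft θ₂ ω) = θ₁ v • contractLeft θ₂ ω - θ₂ v • contractLeft θ₁ ω := by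
  rw [ι_mul_contractLeft, ι_mul_contractLeft_of_mul_eq_zero θ₂ hvω, map_smul]

/-- The coefficient identity behind the dual-functional argument: for `v ∧ ω = v' ∧ ω = 0`,
`v' ∧ v ∧ ι_{θ₁} ι_{θ₂} ω = (θ₁(v) θ₂(v') - θ₂(v) θ₁(v'))·ω`. [cite: BourbakiAlgebre1a3, Ch. III §11 no. 9] -/
theorem ι_mul_ι_mul_contractLeft_contractLeft {θ₁ θ₂ : Module.Dual K V} {v v' : V} {ω : ExteriorAlgebra K V}
    (hvω : ι K v * ω = 0) (hv'ω : ι K v' * ω = 0) :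
    ι K v' * (ι K v * contractLeft θ₁ (contractLeft θ₂ ω)) = (θ₁ v * θ₂ v' - θ₂ v * θ₁ v') • ω := by
  rw [ι_mul_contractLeft_contractLeft hvω, mul_sub, mul_smul_comm, mul_smul_comm,
    ι_mul_contractLeft_of_mul_eq_zero θ₂ hv'ω, ι_mul_contractLeft_of_mul_eq_zero θ₁ hv'ω, smul_smul, smul_smul,
    sub_smul]

/-- `ι_{λ'} ι_λ (q₁ ∧ q₂) = λ(q₁) λ'(q₂) - λ(q₂) λ'(q₁)` (a scalar). [cite: BourbakiAlgebre1a3, Ch. III §11 no. 9] -/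
theorem contractLeft_contractLeft_ι_mul_ι (lam lam' : Module.Dual K V) (q₁ q₂ : V) :
    contractLeft lam' (contractLeft lam (ι K q₁ * ι K q₂)) =
      algebraMap K (ExteriorAlgebra K V) (lam q₁ * lam' q₂ - lam q₂ * lam' q₁) := by
  rw [CliffordAlgebra.contractLeft_ι_mul, CliffordAlgebra.contractLeft_ι, map_sub, map_smul,
    CliffordAlgebra.contractLeft_ι, CliffordAlgebra.contractLeft_mul_algebraMap, CliffordAlgebra.contractLeft_ι,
    ← map_mul, Algebra.smul_def, ← map_mul, ← map_sub]
  congr 1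
  ring

/-! ### 3. Step (i): for `x = a·1 + b·ω` the mixed generators vanish and the span splits into the two blocks -/

section PointIdeal

variable {L : Set V} {Θ : Set (Module.Dual K V)} {ω : ExteriorAlgebra K V}

/-- `q₁ ∧ q₂ ∧ (a·1 + b·ω) = a·(q₁ ∧ q₂)` when `q₂ ∧ ω = 0`. [cite: BourbakiAlgebre1a3, Ch. III §7] -/
theorem gen_wedge_eq (a b : K) {q₁ q₂ : V} (hq₂ : ι K q₂ * ω = 0) :
    ι K q₁ * (ι K q₂ * (algebraMap K _ a + b • ω)) = a • (ι K q₁ * ι K q₂) := by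
  rw [mul_add, mul_smul_comm, hq₂, smul_zero, add_zero, ← Algebra.commutes, ← Algebra.smul_def, mul_smul_comm]

/-- `q ∧ ι_θ (a·1 + b·ω) = 0` when `θ(q) = 0` and `q ∧ ω = 0`. [cite: BourbakiAlgebre1a3, Ch. III §11 no. 9] -/
theorem gen_mixed_eq_zero (a b : K) {q : V} {θ : Module.Dual K V} (hθq : θ q = 0) (hq : ι K q * ω = 0) :
    ι K q * contractLeft θ (algebraMap K _ a + b • ω) = 0 := by
  rw [map_add, CliffordAlgebra.contractLeft_algebraMap, zero_add, map_smul, mul_smul_comm,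
    ι_mul_contractLeft_eq_zero hθq hq, smul_zero]

/-- `ι_{θ₁} ι_{θ₂} (a·1 + b·ω) = b·ι_{θ₁} ι_{θ₂} ω`. [cite: BourbakiAlgebre1a3, Ch. III §11 no. 9] -/
theorem gen_contract_eq (a b : K) (θ₁ θ₂ : Module.Dual K V) :
    contractLeft θ₁ (contractLeft θ₂ (algebraMap K _ a + b • ω)) = b • contractLeft θ₁ (contractLeft θ₂ ω) := by
  rw [map_add, CliffordAlgebra.contractLeft_algebraMap, zero_add, map_smul, map_smul]

/-- **Step (i) of T_lin**: if every `θ ∈ Θ` kills `L` and `q ∧ ω = 0` for `q ∈ L`, then for units `a, b`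
the contraction span of `x = a·1 + b·ω` is the sum of the `Λ²`-block of `L` and the contraction block of `ω`
— the mixed generators `q ∧ ι_θ x` contribute nothing («the `H¹(T)`-block has rank 0 for the pair `(1, pt)`»).
[cite: BourbakiAlgebre1a3, Ch. III §11 no. 9] -/
theorem span_algebraMap_add_smul (hΘL : ∀ θ ∈ Θ, ∀ q ∈ L, θ q = 0) (hLω : ∀ q ∈ L, ι K q * ω = 0)
    {a b : K} (ha : IsUnit a) (hb : IsUnit b) :
    span L Θ (algebraMap K _ a + b • ω) = wedgeBlock L ⊔ contractBlock Θ ω := by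
  apply le_antisymm
  · refine Submodule.span_le.mpr ?_
    rintro y ((⟨q₁, hq₁, q₂, hq₂, rfl⟩ | ⟨q, hq, θ, hθ, rfl⟩) | ⟨θ₁, hθ₁, θ₂, hθ₂, rfl⟩)
    · rw [gen_wedge_eq a b (hLω q₂ hq₂)]
      exact Submodule.mem_sup_left (Submodule.smul_mem _ _ (Submodule.subset_span ⟨q₁, hq₁, q₂, hq₂, rfl⟩))
    · rw [gen_mixed_eq_zero a b (hΘL θ hθ q hq) (hLω q hq)]
      exact Submodule.zero_mem _
    · rw [gen_contract_eq a b]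
      exact Submodule.mem_sup_right (Submodule.smul_mem _ _ (Submodule.subset_span ⟨θ₁, hθ₁, θ₂, hθ₂, rfl⟩))
  · obtain ⟨ua, rfl⟩ := ha
    obtain ⟨ub, rfl⟩ := hb
    refine sup_le (Submodule.span_le.mpr ?_) (Submodule.span_le.mpr ?_)
    · rintro y ⟨q₁, hq₁, q₂, hq₂, rfl⟩
      have h : ι K q₁ * (ι K q₂ * (algebraMap K _ (ua : K) + (ub : K) • ω)) ∈
          span L Θ (algebraMap K _ ua + (ub : K) • ω) :=
        Submodule.subset_span (Or.inl (Or.inl ⟨q₁, hq₁, q₂, hq₂, rfl⟩))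
      rw [gen_wedge_eq _ _ (hLω q₂ hq₂)] at h
      have h' := Submodule.smul_mem _ (↑ua⁻¹ : K) h
      rwa [smul_smul, Units.inv_mul, one_smul] at h'
    · rintro y ⟨θ₁, hθ₁, θ₂, hθ₂, rfl⟩
      have h : contractLeft θ₁ (contractLeft θ₂ (algebraMap K _ (ua : K) + (ub : K) • ω)) ∈
          span L Θ (algebraMap K _ ua + (ub : K) • ω) :=
        Submodule.subset_span (Or.inr ⟨θ₁, hθ₁, θ₂, hθ₂, rfl⟩)
      rw [gen_contract_eq] at h
      have h' := Submodule.smul_mem _ (↑ub⁻¹ : K) h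
      rwa [smul_smul, Units.inv_mul, one_smul] at h'

end PointIdeal

/-! ### 4. Degrees: the blocks live in `Λ²` and `Λ^{d-2}` -/

/-- `Λ⁰ V = K·1`: an element of degree `0` is a scalar. [cite: BourbakiAlgebre1a3, Ch. III §7] -/
theorem exists_eq_algebraMap_of_mem_zero {x : ExteriorAlgebra K V} (hx : x ∈ ⋀[K]^0 V) :
    ∃ r : K, algebraMap K (ExteriorAlgebra K V) r = x := by
  rw [ExteriorAlgebra.exteriorPower, pow_zero, Submodule.mem_one] at hx
  exact hx

/-- **Interior products lower the degree**: `ι_θ (Λⁿ V) ⊆ Λⁿ⁻¹ V` (the argument of the tree's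
`ExteriorLefschetz.ann_apply_mem`). [cite: BourbakiAlgebre1a3, Ch. III §11 no. 9] -/
theorem contractLeft_mem_exteriorPower (θ : Module.Dual K V) {n : ℕ} {x : ExteriorAlgebra K V}
    (hx : x ∈ ⋀[K]^n V) : contractLeft θ x ∈ ⋀[K]^(n - 1) V := by
  induction hx using Submodule.pow_induction_on_left' with
  | algebraMap r => rw [CliffordAlgebra.contractLeft_algebraMap]; exact Submodule.zero_mem _
  | add x y i hx hy ihx ihy => rw [map_add]; exact Submodule.add_mem _ ihx ihy
  | mem_mul m hm i x hx ih =>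
    obtain ⟨v, rfl⟩ := LinearMap.mem_range.mp hm
    rw [CliffordAlgebra.contractLeft_ι_mul, Nat.succ_sub_one]
    refine Submodule.sub_mem _ (Submodule.smul_mem _ _ hx) ?_
    rcases Nat.eq_zero_or_pos i with rfl | hi
    · obtain ⟨r, rfl⟩ := exists_eq_algebraMap_of_mem_zero hx
      rw [CliffordAlgebra.contractLeft_algebraMap, mul_zero]
      exact Submodule.zero_mem _
    · have : ι K v * contractLeft θ x ∈ ⋀[K]^(1 + (i - 1)) V := by
        rw [ExteriorAlgebra.exteriorPower, pow_add, pow_one]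
        exact Submodule.mul_mem_mul (LinearMap.mem_range_self _ v) ih
      rwa [show 1 + (i - 1) = i by omega] at this

/-- `q₁ ∧ q₂ ∈ Λ² V`. [cite: BourbakiAlgebre1a3, Ch. III §7] -/
theorem ι_mul_ι_mem_two (q₁ q₂ : V) : ι K q₁ * ι K q₂ ∈ ⋀[K]^2 V := by
  rw [ExteriorAlgebra.exteriorPower, pow_two]
  exact Submodule.mul_mem_mul (LinearMap.mem_range_self _ q₁) (LinearMap.mem_range_self _ q₂)

/-- The `Λ²`-block lies in degree `2`. [cite: BourbakiAlgebre1a3, Ch. III §7] -/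
theorem wedgeBlock_le (L : Set V) : wedgeBlock (K := K) L ≤ ⋀[K]^2 V :=
  Submodule.span_le.mpr (by rintro y ⟨q₁, -, q₂, -, rfl⟩; exact ι_mul_ι_mem_two q₁ q₂)

/-- The contraction block of `ω ∈ Λᵈ V` lies in degree `d - 2`. [cite: BourbakiAlgebre1a3, Ch. III §11 no. 9] -/
theorem contractBlock_le (Θ : Set (Module.Dual K V)) {d : ℕ} {ω : ExteriorAlgebra K V} (hω : ω ∈ ⋀[K]^d V) :
    contractBlock Θ ω ≤ ⋀[K]^(d - 2) V :=
  Submodule.span_le.mpr (by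
    rintro y ⟨θ₁, -, θ₂, -, rfl⟩
    have h := contractLeft_mem_exteriorPower θ₁ (contractLeft_mem_exteriorPower θ₂ hω)
    rwa [show d - 1 - 1 = d - 2 by omega] at h)

/-- `v ∧ ω ∈ Λ^{d+1} V` for `ω ∈ Λᵈ V`. [cite: BourbakiAlgebre1a3, Ch. III §7] -/
theorem ι_mul_mem_succ (v : V) {d : ℕ} {ω : ExteriorAlgebra K V} (hω : ω ∈ ⋀[K]^d V) :
    ι K v * ω ∈ ⋀[K]^(d + 1) V := by
  rw [ExteriorAlgebra.exteriorPower, pow_succ']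
  exact Submodule.mul_mem_mul (LinearMap.mem_range_self _ v) hω

end Ring

/-! ### 5. Over a field: the `Λ²`-block has dimension `C(dim L, 2)` -/

section Field

variable {K : Type*} [Field K] {V : Type*} [AddCommGroup V] [Module K V]

/-- For `n = 2`, `ιMulti (v₀, v₁) = v₀ ∧ v₁`. [cite: BourbakiAlgebre1a3, Ch. III §7] -/
theorem ιMulti_two (w : Fin 2 → V) : ExteriorAlgebra.ιMulti K 2 w = ι K (w 0) * ι K (w 1) := by
  rw [ExteriorAlgebra.ιMulti_succ_apply, ExteriorAlgebra.ιMulti_succ_apply, ExteriorAlgebra.ιMulti_zero_apply,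
    mul_one]
  rfl

/-- **The `Λ²`-block of a spanned subspace is the image of its second exterior power**: for a family `v`,
`wedgeBlock (span v) = (Λ² V).subtype (range (Λ² (span v ↪ V)))`, the latter being the span of the pairwise products
of `v` (Mathlib `exteriorPower.ιMulti_family_span`). [cite: BourbakiAlgebre1a3, Ch. III §7 no. 2] -/
theorem wedgeBlock_span_eq {I : Type*} [LinearOrder I] (v : I → V) :
    wedgeBlock (K := K) (Submodule.span K (Set.range v) : Set V) =
      (Submodule.span K (Set.range (exteriorPower.ιMulti_family K 2 v))).map (⋀[K]^2 V).subtype := by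
  rw [← exteriorPower.ιMulti_family_span]
  apply le_antisymm
  · refine Submodule.span_le.mpr ?_
    rintro y ⟨q₁, hq₁, q₂, hq₂, rfl⟩
    refine ⟨exteriorPower.ιMulti K 2 ![q₁, q₂], ⟨exteriorPower.ιMulti K 2 ![⟨q₁, hq₁⟩, ⟨q₂, hq₂⟩], ?_⟩, ?_⟩
    · rw [exteriorPower.map_apply_ιMulti]; rfl
    · rw [Submodule.coe_subtype, exteriorPower.ιMulti_apply_coe, ιMulti_two]; rfl
  · rintro y ⟨z, ⟨w, rfl⟩, rfl⟩
    -- `w ∈ Λ² (span v)` is in the span of the `ιMulti` of pairs; push through the two maps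
    have hw : w ∈ Submodule.span K (Set.range (exteriorPower.ιMulti K 2 (M := Submodule.span K (Set.range v)))) := by
      rw [exteriorPower.ιMulti_span]; exact Submodule.mem_top
    rw [Submodule.coe_subtype]
    induction hw using Submodule.span_induction with
    | mem x hx =>
      obtain ⟨u, rfl⟩ := hx
      rw [exteriorPower.map_apply_ιMulti, exteriorPower.ιMulti_apply_coe, ιMulti_two]
      exact Submodule.subset_span ⟨(u 0 : V), (u 0).2, (u 1 : V), (u 1).2, rfl⟩
    | zero => rw [map_zero, ZeroMemClass.coe_zero]; exact Submodule.zero_mem _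
    | add x y _ _ hx hy => rw [map_add, Submodule.coe_add]; exact Submodule.add_mem _ hx hy
    | smul c x _ hx => rw [map_smul, Submodule.coe_smul]; exact Submodule.smul_mem _ c hx

/-- **`dim Λ²`-block `= C(dim L, 2)`** for a spanned finite-dimensional subspace `L = span v`: `Λ²(L ↪ V)` is
injective over a field (`exteriorPower.map_injective_field`) and `dim Λ² L = C(dim L, 2)`
(`exteriorPower.finrank_eq`).
[cite: BourbakiAlgebre1a3, Ch. III §7 no. 8 (Thm. 1: bases of Λ(M))] -/
theorem finrank_wedgeBlock_span {I : Type*} [LinearOrder I] (v : I → V)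
    [FiniteDimensional K (Submodule.span K (Set.range v))] :
    Module.finrank K (wedgeBlock (K := K) (Submodule.span K (Set.range v) : Set V)) =
      (Module.finrank K (Submodule.span K (Set.range v))).choose 2 := by
  rw [wedgeBlock_span_eq, ← exteriorPower.ιMulti_family_span,
    Submodule.finrank_map_subtype_eq, LinearMap.finrank_range_of_inj
      (exteriorPower.map_injective_field (Submodule.injective_subtype _)),
    exteriorPower.finrank_eq]

/-- **`dim Λ²`-block of a finite-dimensional subspace `L` is `C(dim L, 2)`.**
[cite: BourbakiAlgebre1a3, Ch. III §7 no. 8] -/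
theorem finrank_wedgeBlock (L : Submodule K V) [FiniteDimensional K L] :
    Module.finrank K (wedgeBlock (K := K) (L : Set V)) = (Module.finrank K L).choose 2 := by
  classical
  letI : LinearOrder L := linearOrderOfSTO WellOrderingRel
  have hrange : Set.range (Subtype.val : L → V) = (L : Set V) := Subtype.range_coe
  have hL : Submodule.span K (Set.range (Subtype.val : L → V)) = L := by rw [hrange, Submodule.span_eq]
  haveI : FiniteDimensional K (Submodule.span K (Set.range (Subtype.val : L → V))) := by rw [hL]; infer_instance
  have h := finrank_wedgeBlock_span (K := K) (Subtype.val : L → V)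
  rw [hL] at h
  exact h

end Field

end ContractionSpan

/-! ### 6. Bridge to `PerfectComplexRankDoor.lean` -/

/-- The span of `contractionSet A κ` IS the abstract contraction span at
`(V, L, Θ, x) = (H¹(A), hodgeZeroOneSet A, vectorFieldSet A, totalExteriorClass A κ)` (definitional).
[cite: BuchweitzFlenner2008HH, Prop. 6.4.4] -/
theorem span_contractionSet_eq (A : AbelianVariety ℂ) (κ : ∀ p : ℕ, complexBetti A.X (2 * p)) :
    Submodule.span ℂ (contractionSet A κ) =
      ContractionSpan.span (hodgeZeroOneSet A) (vectorFieldSet A) (totalExteriorClass A κ) :=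
  rfl

/-- `contractionRank A κ` is the rank of the abstract contraction span (definitional) — so the structure theorems
of this file and its sequel compute `contractionRank` once `totalExteriorClass A κ` is put in the form `a·1 + b·ω`
(point ideal) or a product of such (Künneth, th-7 §N.3). [cite: BuchweitzFlenner2008HH, Prop. 6.4.4] -/
theorem contractionRank_eq_rank_span (A : AbelianVariety ℂ) (κ : ∀ p : ℕ, complexBetti A.X (2 * p)) :
    contractionRank A κ =
      Module.rank ℂ (ContractionSpan.span (hodgeZeroOneSet A) (vectorFieldSet A) (totalExteriorClass A κ)) :=
  rfl

end Summit.Ventures.HSemireg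

end
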